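import Summits.AtomisticToContinuum.Crystallization.Theorems.ChargedEnergyGapChartRows
import HarnessLib

/-!
# ChargedEnergyGap · NODE 110A «StationRows» — seven-point rows, LINEAR in the squared depths (door D5 of memo CELLCHECKER-SPEC-g92 §10)

decomp-a2c lens-3 g92 (imports NODE 109A «ChartRows»).

Memo §9 (FINDING «TRANSVERSE-BULK-92») shows that no TILING of the admissible depth region by cost cells can close the census: the cost varies
by ≈ 8 × cap across the transverse extent of one `(t, ρ)` station, so boxes must be tiny in all seven directions (≥ 10⁸ cells).  Door D5
(«StationPolytope») replaces tiling by CONVEXITY ON A POLYTOPE: for a station (a `t`-range and a `ρ`-slab) the chart-realisable tuples are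
enclosed in ONE polytope cut out by realisability rows, and those rows are LINEAR IN THE SQUARED DEPTHS `D_q = dt q²`.  This node supplies them:

* `stPt` — the seven stencil points indexed by `Option (Fin 3 × Bool)` (`none` = centre, `some e` = `holeVertex 0 e`), all in `stencil 0`;
* `sevenRow_of_chart` — the aggregated row of NODE 109A for ANY owner among the seven points against all seven (centre included), in coordinates;
* `two_mul_le_add_sq_div` — AM–GM `2·x ≤ s + x²/s` (`0 < s`): the only non-linear term `2·ρ·n·dt p` of a row is dominated by a form LINEAR in
  `dt p²`, with NO range hypothesis (tangent of the concave square root);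
* ★★ `stationRow_of_chart` — the resulting inequality, linear in the seven squares with rational data `(α, n, s, G)`:
  `Σ_{o'} α_{o'}·dt(o')² ≤ (Σ_{o'} α_{o'} + ρ·n/s)·dt(o)² + ρ·n·s + ρ²·Σ_{o'} α_{o'}·G(o,o')`;
* `sq_le_chord`, `tangent_le_sq` — the two elementary brackets `x² ≤ (a+b)·x − a·b` on `[a,b]` and `2·c·x − c² ≤ x²` that let a checker carry
  BOTH `dt` and `dt²` as LP variables (kink, sector and station walls are linear in `dt`; rows are linear in `dt²`);
* `abs_le_of_chart` — the exact Lipschitz consequence `|dt q| ≤ dt p + ρ·m` (`m² ≥ G(p,q)`) giving the coordinate ranges a station starts from.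

No new analysis.  The brackets for the weights `W_q = depthProfile 160 (dt q)` are NODE 97's `depthProfile_chord_upper` / `depthProfile_secant_lower`
and are not restated.  No placeholders.

[SPLIT beneath (T¹ᶜ) (no EQUIV introduced) · Level-F primitive: the H-description of a station polytope · UNDECIDED(test = (D¹)) unchanged.] -/

noncomputable section
open scoped Classical
open Literature.MathematicalPhysics.StatisticalMechanics Literature.Geometry.DiscreteGeometry
open Summit.AtomisticToContinuum.Crystallization.Theses.PricedLinkCensus
open Summit.AtomisticToContinuum.Crystallization.Theorems.ChargedEnergyGapNegative

namespace Summit.AtomisticToContinuum.Crystallization.Theorems.ChargedEnergyGapChartDial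

/-! ## §110.1 The seven stencil points -/
section SevenPoints

/-- The seven points of the standard stencil `stencil 0`, indexed by `Option (Fin 3 × Bool)`: `none` is the centre `0`, `some e` the vertex
`holeVertex 0 e`. -/
def stPt : Option (Fin 3 × Bool) → Fin 3 → ℤ
  | none => 0
  | some e => holeVertex 0 e

/-- [formal bookkeeping] `stPt none = 0`. -/
@[simp] theorem stPt_none : stPt none = 0 := rfl

/-- [formal bookkeeping] `stPt (some e) = holeVertex 0 e`. -/
@[simp] theorem stPt_some (e : Fin 3 × Bool) : stPt (some e) = holeVertex 0 e := rfl

/-- Every one of the seven points lies in `stencil 0`. -/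
theorem stPt_mem (o : Option (Fin 3 × Bool)) : stPt o ∈ stencil 0 := by
  cases o with
  | none => exact mem_stencil_self 0
  | some e => exact mem_stencil_vertex 0 e

/-- The squared integer distance `G(o,o') = Σₖ ((stPt o')ₖ − (stPt o)ₖ)²` between two of the seven points, as a real number. -/
def stG (o o' : Option (Fin 3 × Bool)) : ℝ := ∑ k, (((stPt o') k - (stPt o) k : ℤ) : ℝ) ^ 2

end SevenPoints

/-! ## §110.2 Seven-point aggregated rows -/
section SevenRows

/-- **SEVEN-POINT ROW IN COORDINATES** (NODE 109A `realisRow_aggregate` read off `IsChartRealisable` for any owner `o` among the seven points,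
members all seven): for multipliers `α ≥ 0` and any `N ≥ 0` with `ρ²·Σₖ (Σ_{o'} α_{o'} ((stPt o')ₖ − (stPt o)ₖ))² ≤ N²`,
`0 ≤ Σ_{o'} α_{o'}·(ρ²·G(o,o') + dt(stPt o)² − dt(stPt o')²) + 2·dt(stPt o)·N`. -/
theorem sevenRow_of_chart {ρ : ℝ} {dt : (Fin 3 → ℤ) → ℝ} (h : IsChartRealisable ρ dt) (o : Option (Fin 3 × Bool))
    (hp0 : 0 ≤ dt (stPt o)) (α : Option (Fin 3 × Bool) → ℝ) (hα : ∀ o', 0 ≤ α o') {N : ℝ} (hN0 : 0 ≤ N)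
    (hN : ρ ^ 2 * ∑ k, (∑ o', α o' * (((stPt o') k - (stPt o) k : ℤ) : ℝ)) ^ 2 ≤ N ^ 2) :
    0 ≤ (∑ o', α o' * (ρ ^ 2 * stG o o' + dt (stPt o) ^ 2 - dt (stPt o') ^ 2)) + 2 * dt (stPt o) * N := by
  obtain ⟨u, hu, hrow⟩ := h (stPt o) (stPt_mem o)
  have hnorm : ‖∑ o' ∈ Finset.univ, α o' • (stdPt ρ (stPt o') - stdPt ρ (stPt o))‖ ≤ N := by
    refine abs_le_of_sq_le_sq' ?_ hN0 |>.2
    rw [norm_sum_smul_stdPt_sub_sq]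
    exact hN
  have := realisRow_aggregate hu hp0 Finset.univ (fun o' => stPt o') α (fun o' _ => hα o')
    (fun o' _ => hrow _ (stPt_mem o')) hnorm
  simp only [norm_stdPt_sub_sq] at this
  exact this

/-- [formal bookkeeping] AM–GM in the form used to linearise the pole term: `2·x ≤ s + x²/s` for `0 < s` (tangent of the concave square root at
`s`; no range hypothesis on `x`). -/
theorem two_mul_le_add_sq_div {x s : ℝ} (hs : 0 < s) : 2 * x ≤ s + x ^ 2 / s := by
  rw [show s + x ^ 2 / s = (s ^ 2 + x ^ 2) / s by field_simp, le_div_iff₀ hs]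
  nlinarith [sq_nonneg (x - s)]

/-- ★★ **STATION ROW, LINEAR IN THE SQUARED DEPTHS**: for a chart-realisable tuple with `0 ≤ dt` at the owner `o`, a frame scale `0 ≤ ρ`,
multipliers `α ≥ 0`, an integer-vector norm bound `n ≥ 0` (`Σₖ (Σ_{o'} α_{o'} ((stPt o')ₖ − (stPt o)ₖ))² ≤ n²`) and any slope point `0 < s`:
`Σ_{o'} α_{o'}·dt(stPt o')² ≤ (Σ_{o'} α_{o'} + ρ·n/s)·dt(stPt o)² + ρ·n·s + ρ²·Σ_{o'} α_{o'}·G(o,o')`.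
All data are rational in a census; the inequality is linear in the seven squares `dt(stPt ·)²`. -/
theorem stationRow_of_chart {ρ : ℝ} {dt : (Fin 3 → ℤ) → ℝ} (h : IsChartRealisable ρ dt) (hρ : 0 ≤ ρ) (o : Option (Fin 3 × Bool))
    (hp0 : 0 ≤ dt (stPt o)) (α : Option (Fin 3 × Bool) → ℝ) (hα : ∀ o', 0 ≤ α o') {n : ℝ} (hn0 : 0 ≤ n)
    (hn : ∑ k, (∑ o', α o' * (((stPt o') k - (stPt o) k : ℤ) : ℝ)) ^ 2 ≤ n ^ 2) {s : ℝ} (hs : 0 < s) :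
    ∑ o', α o' * dt (stPt o') ^ 2
      ≤ (∑ o', α o' + ρ * n / s) * dt (stPt o) ^ 2 + ρ * n * s + ρ ^ 2 * ∑ o', α o' * stG o o' := by
  have hN : ρ ^ 2 * ∑ k, (∑ o', α o' * (((stPt o') k - (stPt o) k : ℤ) : ℝ)) ^ 2 ≤ (ρ * n) ^ 2 := by
    rw [mul_pow]
    exact mul_le_mul_of_nonneg_left hn (sq_nonneg ρ)
  have hrow := sevenRow_of_chart h o hp0 α hα (mul_nonneg hρ hn0) hN
  have hsplit : ∑ o', α o' * (ρ ^ 2 * stG o o' + dt (stPt o) ^ 2 - dt (stPt o') ^ 2)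
      = ρ ^ 2 * ∑ o', α o' * stG o o' + (∑ o', α o') * dt (stPt o) ^ 2 - ∑ o', α o' * dt (stPt o') ^ 2 := by
    rw [Finset.mul_sum, Finset.sum_mul, ← Finset.sum_add_distrib, ← Finset.sum_sub_distrib]
    exact Finset.sum_congr rfl fun o' _ => by ring
  have hamgm : 2 * dt (stPt o) * (ρ * n) ≤ ρ * n * s + ρ * n / s * dt (stPt o) ^ 2 := by
    have h2 := two_mul_le_add_sq_div (x := dt (stPt o)) hs
    have hρn : 0 ≤ ρ * n := mul_nonneg hρ hn0
    have := mul_le_mul_of_nonneg_left h2 hρn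
    have hrw : ρ * n * (s + dt (stPt o) ^ 2 / s) = ρ * n * s + ρ * n / s * dt (stPt o) ^ 2 := by
      field_simp
    linarith [hrw]
  rw [hsplit] at hrow
  nlinarith [hrow, hamgm]

end SevenRows

/-! ## §110.3 One-dimensional brackets and coordinate ranges -/
section Brackets

/-- [formal bookkeeping] chord of the convex square: `x² ≤ (a+b)·x − a·b` for `x ∈ [a,b]`. -/
theorem sq_le_chord {a b x : ℝ} (ha : a ≤ x) (hb : x ≤ b) : x ^ 2 ≤ (a + b) * x - a * b := by
  nlinarith [mul_nonneg (sub_nonneg.2 ha) (sub_nonneg.2 hb)]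

/-- [formal bookkeeping] tangent of the convex square: `2·c·x − c² ≤ x²` for every `c`. -/
theorem tangent_le_sq (c x : ℝ) : 2 * c * x - c ^ 2 ≤ x ^ 2 := by
  nlinarith [sq_nonneg (x - c)]

/-- **COORDINATE RANGES FROM ONE ROW** (exact, no linearisation): for a chart-realisable tuple, two of the seven points `o` (owner, `0 ≤ dt`) and
`o'`, a frame scale `0 ≤ ρ` and any `m ≥ 0` with `G(o,o') ≤ m²`: `|dt(stPt o')| ≤ dt(stPt o) + ρ·m`.  (With `o ↔ o'` exchanged this pins every
depth of a station to within `ρ·m` of the pole depths.) -/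
theorem abs_le_of_chart {ρ : ℝ} {dt : (Fin 3 → ℤ) → ℝ} (h : IsChartRealisable ρ dt) (hρ : 0 ≤ ρ) (o o' : Option (Fin 3 × Bool))
    (hp0 : 0 ≤ dt (stPt o)) {m : ℝ} (hm0 : 0 ≤ m) (hm : stG o o' ≤ m ^ 2) :
    |dt (stPt o')| ≤ dt (stPt o) + ρ * m := by
  -- the single row `α = indicator of o'`, with `N = ρ·m`
  set α : Option (Fin 3 × Bool) → ℝ := fun x => if x = o' then 1 else 0 with hαdef
  have hα : ∀ x, 0 ≤ α x := fun x => by simp only [hαdef]; split_ifs <;> norm_num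
  have hsumk : ∑ k, (∑ x, α x * (((stPt x) k - (stPt o) k : ℤ) : ℝ)) ^ 2 = stG o o' := by
    simp only [hαdef, ite_mul, one_mul, zero_mul, Finset.sum_ite_eq', Finset.mem_univ, if_true]
    rfl
  have hN : ρ ^ 2 * ∑ k, (∑ x, α x * (((stPt x) k - (stPt o) k : ℤ) : ℝ)) ^ 2 ≤ (ρ * m) ^ 2 := by
    rw [hsumk, mul_pow]
    exact mul_le_mul_of_nonneg_left hm (sq_nonneg ρ)
  have hrow := sevenRow_of_chart h o hp0 α hα (mul_nonneg hρ hm0) hN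
  have hsum : ∑ x, α x * (ρ ^ 2 * stG o x + dt (stPt o) ^ 2 - dt (stPt x) ^ 2)
      = ρ ^ 2 * stG o o' + dt (stPt o) ^ 2 - dt (stPt o') ^ 2 := by
    simp only [hαdef, ite_mul, one_mul, zero_mul, Finset.sum_ite_eq', Finset.mem_univ, if_true]
  rw [hsum] at hrow
  have hsq : dt (stPt o') ^ 2 ≤ (dt (stPt o) + ρ * m) ^ 2 := by
    have hρm : 0 ≤ ρ * m := mul_nonneg hρ hm0
    nlinarith [hrow, mul_le_mul_of_nonneg_left hm (sq_nonneg ρ), hρm, hp0]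
  exact abs_le_of_sq_le_sq' hsq (by positivity) |> fun hh => abs_le.2 ⟨by linarith [hh.1], hh.2⟩

end Brackets

end Summit.AtomisticToContinuum.Crystallization.Theorems.ChargedEnergyGapChartDial
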